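/-
Copyright (c) 2026 The 21-frontier cell rh-split. All rights reserved.
Released under Apache 2.0 license as described in the file LICENSE.
Authors: rh-split-screw-bridge (gen 19)
-/
import Summits.RiemannHypothesis.RiemannHypothesis.Theorems.Splittings.SlidingTheftGermRemoval

/-!
# «SLIDING THEFT GERM» — K7′ «removal + sliding»: the second side of the price (upper count law)

§15 of the lane-#10 object (optional file S; §14 = `SlidingTheftGermRemoval` is the first side).  Over the tree's
`Config.psi`, ζ-free: `atomUpper m κ Y` (one atom's upper weight at height `Y`: `(53/24)·m` if `‖κ‖ ≤ Y`, else
`12·m·Y²/(Im κ)²`), `towerSmooth Z Y := Σ'_i [atomUpper m₁ κ₁ Y + atomUpper m₂ κ₂ Y]` (summable under `GermHyp`: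
`GermHyp.summable_atomUpper`);
`Config.psi_le_towerSmooth : GermHyp σs Z → 1 ≤ Y → Z.psi (1/Y) ≤ (1/Y)²·towerSmooth Z Y`;
`sum_theftTerm_le` (partial sums over `F ⊇ G`, `G` removed: `≤ 601Aη̄t²log(1/t) − Σ_{k∈G} g(γ_k,t)`, by the
two-sided (G2) sum `abs_sum_slide_le_of_countHyp` and `−g ≤ 0`); `le_of_hasSum_of_sum_le` (limit along finsets);
**`removedNear_le_of_removalSlidingTheft`** — the UPPER COUNT LAW: under `GermHyp σ* Z`, `U > 0`, `η̄ ≤ 1/2`,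
`RemovalSlidingTheft U η̄ A Z γ η rem`, for `Y ≥ max(4, 1/U)` and every finite set `G` of removed indices,
`(11/12)·#{k ∈ G : γ_k ≤ Y} ≤ towerSmooth Z Y + 601·A·η̄·log Y` («over-removal is impossible»: below each height
one cannot remove more zeros than a smoothed weight of the tower, up to the sliding slack); `removedNear_le_trivial`
(the pure-sliding reading `G = ∅`).  With §14 the removed count is tied to the tower's weight from BOTH sides within
constant factors at every height.
NOT HERE / NOT CLAIMED: the exact factor `2` of the two-sided exchange (theory-1 K7-COUNT-LAW-2SIDED 48c9a1a6, paper);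
any decision of B33 Q_C clause 3 / K7′ (the existence of removal + sliding thefts is the open CONSTRUCTION question,
rh-idea-4's side); constants are crude (`53/24`, `12`, `11/12`, `601`).

HONEST LABEL: elementary real analysis + `tsum` comparison; an INSTRUMENT (necessary condition for another seat's
conjectured mechanism); ζ-free, RH-free; toward RH: 0.  Nothing here bears on the truth of RH.
-/

set_option linter.dupNamespace false

namespace Summit.RiemannHypothesis.RiemannHypothesis.Theorems.Splittings.SlidingGerm

open Summit.RiemannHypothesis.RiemannHypothesis.Theorems.Splittings.ScrewLatticeTower
open Summit.RiemannHypothesis.RiemannHypothesis.Theorems.Splittings.ScrewLatticeWolff (quadTerm)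

/-! ## 15. The second side of the price: over-removal is impossible (upper count law)

§14 bounds the (smoothed) REMOVED count from BELOW by the tower's unresolved weight.  Here the converse direction
at constants level: the number of removed zeros BELOW a height `Y` is bounded ABOVE by a smoothed weight of the
tower at `Y` plus the sliding slack — «one cannot remove more zeros than the tower shows».  Mechanism: in the K7′
identity `Σ_k theftTerm_k(t) = −Ψ_Z(t)` every removed index contributes `−g(γ_k,t) ≤ 0` and the slides contribute
at most `601·A·η̄·t²·log(1/t)` in absolute value ((G2) summed, two-sided), so for every finite set `G` of removed
indices `Σ_{k∈G} g(γ_k,t) ≤ Ψ_Z(t) + 601·A·η̄·t²·log(1/t)`; a removed pair BELOW `Y = 1/t` supplies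
`g ≥ t² − γ²t⁴/12 ≥ (11/12)t²` (`sq_sub_le_pairTrace`), and `Ψ_Z(1/Y) ≤ Y⁻²·towerSmooth_Z(Y)` atom by atom
(germ upper bound `(53/24)m t²` for `‖κ‖ ≤ Y`, size bound `12 m/γ²` otherwise).  Together with §14 the removed
count is pinned to the tower's weight at every height within CONSTANT factors, both ways; the exact factor `2`
of theory-1's paper form (K7-COUNT-LAW-2SIDED) is not claimed. -/

/-- One atom's UPPER weight at height `Y`: `(53/24)·m` if the atom is unresolved at `t = 1/Y` (`‖κ‖ ≤ Y`: germ
upper bound `quadTerm ≤ (53/24) m t²`), else `12·m·Y²/γ²` (size bound `|quadTerm| ≤ 12 m/γ²`, `γ = Im κ`). -/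
noncomputable def atomUpper (m : ℝ) (κ : ℂ) (Y : ℝ) : ℝ :=
  if ‖κ‖ ≤ Y then 53 / 24 * m else 12 * m * Y ^ 2 / κ.im ^ 2

/-- `atomUpper ≥ 0` for `m ≥ 0`. -/
theorem atomUpper_nonneg {m : ℝ} (hm : 0 ≤ m) (κ : ℂ) (Y : ℝ) : 0 ≤ atomUpper m κ Y := by
  unfold atomUpper
  split_ifs <;> positivity

/-- The uniform majorant `atomUpper m κ Y ≤ 12·Y²·(m/γ²)` (`m ≥ 0`, `γ = Im κ > 0`), which makes the tower-side
smoothed weight summable under `GermHyp`. -/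
theorem atomUpper_le {m : ℝ} {κ : ℂ} (hm : 0 ≤ m) (hγ : 0 < κ.im) (Y : ℝ) :
    atomUpper m κ Y ≤ 12 * Y ^ 2 * (m / κ.im ^ 2) := by
  unfold atomUpper
  split_ifs with h
  · have him : κ.im ≤ Y := le_trans (le_trans (le_abs_self _) (Complex.abs_im_le_norm κ)) h
    have hsq : κ.im ^ 2 ≤ Y ^ 2 := pow_le_pow_left₀ hγ.le him 2
    have h1 : 1 ≤ Y ^ 2 / κ.im ^ 2 := by rw [le_div_iff₀ (by positivity)]; linarith
    have e : 12 * Y ^ 2 * (m / κ.im ^ 2) = 12 * m * (Y ^ 2 / κ.im ^ 2) := by ring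
    rw [e]
    nlinarith [mul_le_mul_of_nonneg_left h1 (by positivity : (0 : ℝ) ≤ 12 * m)]
  · exact le_of_eq (by ring)

/-- The atom term of `Ψ_Z` at `t = 1/Y` is at most `Y⁻²·atomUpper` (`m ≥ 0`, `Re κ ≥ 0`, `Im κ > 0`, `Y > 0`,
`Re κ / Y ≤ 1`). -/
theorem quadTerm_le_atomUpper {m : ℝ} {κ : ℂ} {Y : ℝ} (hm : 0 ≤ m) (hσ0 : 0 ≤ κ.re) (hγ : 0 < κ.im)
    (hY : 0 < Y) (hσt : κ.re * (1 / Y) ≤ 1) :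
    quadTerm m κ (1 / Y) ≤ (1 / Y) ^ 2 * atomUpper m κ Y := by
  have hκ : κ ≠ 0 := fun e ↦ by rw [e] at hγ; simp at hγ
  unfold atomUpper
  split_ifs with h
  · have h1 : ‖κ‖ * |1 / Y| ≤ 1 := by
      rw [abs_of_pos (by positivity), mul_one_div, div_le_one hY]; exact h
    have := (quadTerm_germ_bounds hm hκ h1).2
    linarith
  · have hb := abs_quadTerm_le (m := m) hσ0 hγ (by positivity : (0 : ℝ) ≤ 1 / Y) hσt
    rw [abs_of_nonneg hm] at hb
    have hq := (abs_le.mp hb).2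
    have e : (1 / Y) ^ 2 * (12 * m * Y ^ 2 / κ.im ^ 2) = 12 * m / κ.im ^ 2 := by
      field_simp
    linarith

/-- The TOWER-SIDE SMOOTHED WEIGHT at height `Y`: `Σ'_i [atomUpper m₁ κ₁ Y + atomUpper m₂ κ₂ Y]` — unresolved
atoms (`‖κ‖ ≤ Y`) count `(53/24)·m`, the others `12·m·Y²/γ²`; both families.  (For the one-parameter towers of
the cell this is `O(N_Z(Y)) + O(Y²·Σ_{γ_i > Y} m_i/γ_i²)`.) -/
noncomputable def towerSmooth (Z : Config) (Y : ℝ) : ℝ :=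
  ∑' i, (atomUpper (Z.m₁ i) (Z.κ₁ i) Y + atomUpper (Z.m₂ i) (Z.κ₂ i) Y)

/-- Under `GermHyp` the tower-side smoothed weight is a convergent series (majorant `12Y²·(m₁/γ₁² + m₂/γ₂²)`). -/
theorem GermHyp.summable_atomUpper {σs : ℝ} {Z : Config} (hZ : GermHyp σs Z) (Y : ℝ) :
    Summable fun i ↦ atomUpper (Z.m₁ i) (Z.κ₁ i) Y + atomUpper (Z.m₂ i) (Z.κ₂ i) Y := by
  refine Summable.of_nonneg_of_le (fun i ↦ ?_) (fun i ↦ ?_) (hZ.summable.mul_left (12 * Y ^ 2))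
  · have hm := hZ.m_nonneg i
    exact add_nonneg (atomUpper_nonneg hm.1 _ _) (atomUpper_nonneg hm.2 _ _)
  · have hm := hZ.m_nonneg i
    have h2 := hZ.one_le_im i
    have b1 := atomUpper_le hm.1 (by linarith [h2.1] : 0 < (Z.κ₁ i).im) Y
    have b2 := atomUpper_le hm.2 (by linarith [h2.2] : 0 < (Z.κ₂ i).im) Y
    calc atomUpper (Z.m₁ i) (Z.κ₁ i) Y + atomUpper (Z.m₂ i) (Z.κ₂ i) Y
        ≤ 12 * Y ^ 2 * (Z.m₁ i / (Z.κ₁ i).im ^ 2) + 12 * Y ^ 2 * (Z.m₂ i / (Z.κ₂ i).im ^ 2) := add_le_add b1 b2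
      _ = 12 * Y ^ 2 * (Z.m₁ i / (Z.κ₁ i).im ^ 2 + Z.m₂ i / (Z.κ₂ i).im ^ 2) := by ring

/-- `towerSmooth ≥ 0` under `GermHyp`. -/
theorem towerSmooth_nonneg {σs : ℝ} {Z : Config} (hZ : GermHyp σs Z) (Y : ℝ) : 0 ≤ towerSmooth Z Y :=
  tsum_nonneg fun i ↦ by
    have hm := hZ.m_nonneg i
    exact add_nonneg (atomUpper_nonneg hm.1 _ _) (atomUpper_nonneg hm.2 _ _)

/-- **TOWER TRACE UPPER BOUND.**  Under `GermHyp σ* Z`, for `Y ≥ 1`: `Ψ_Z(1/Y) ≤ Y⁻²·towerSmooth_Z(Y)`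
(atom by atom: `quadTerm_le_atomUpper`; `tsum` comparison against the summable majorant). -/
theorem Config.psi_le_towerSmooth {σs : ℝ} {Z : Config} (hZ : GermHyp σs Z) {Y : ℝ} (hY : 1 ≤ Y) :
    Z.psi (1 / Y) ≤ (1 / Y) ^ 2 * towerSmooth Z Y := by
  have hYpos : 0 < Y := by linarith
  have ht0 : (0 : ℝ) ≤ 1 / Y := by positivity
  have ht1 : 1 / Y ≤ 1 := (div_le_one hYpos).mpr hY
  have hsum := hZ.summable_terms ht0 ht1
  have hmaj := (hZ.summable_atomUpper Y).mul_left ((1 / Y) ^ 2)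
  have hle : ∀ i, quadTerm (Z.m₁ i) (Z.κ₁ i) (1 / Y) + quadTerm (Z.m₂ i) (Z.κ₂ i) (1 / Y)
      ≤ (1 / Y) ^ 2 * (atomUpper (Z.m₁ i) (Z.κ₁ i) Y + atomUpper (Z.m₂ i) (Z.κ₂ i) Y) := by
    intro i
    have h1 := hZ.re_mem i
    have h2 := hZ.one_le_im i
    have hm := hZ.m_nonneg i
    have hσt₁ : (Z.κ₁ i).re * (1 / Y) ≤ 1 := by nlinarith [hZ.σs_le, h1.1.1, h1.1.2]
    have hσt₂ : (Z.κ₂ i).re * (1 / Y) ≤ 1 := by nlinarith [hZ.σs_le, h1.2.1, h1.2.2]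
    have q1 := quadTerm_le_atomUpper hm.1 h1.1.1 (by linarith [h2.1]) hYpos hσt₁
    have q2 := quadTerm_le_atomUpper hm.2 h1.2.1 (by linarith [h2.2]) hYpos hσt₂
    linarith
  have key := hsum.tsum_le_tsum hle hmaj
  rw [tsum_mul_left] at key
  exact key

/-- UPPER BOUND ON THE PARTIAL SUMS of the K7′ series beyond a finite removed set `G`: for `F ⊇ G`,
`Σ_{k∈F} theftTerm_k(t) ≤ 601·A·η̄·t²·log(1/t) − Σ_{k∈G} g(γ_k,t)` (`0 < t ≤ 1/4`): the other removed indices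
contribute `≤ 0`, the kept ones their slides, bounded two-sidedly by (G2) summed. -/
theorem sum_theftTerm_le {A ηbar t : ℝ} {γ η : ℕ → ℝ} {rem : ℕ → Bool} (hA : CountHyp A γ)
    (hγ : ∀ k, 1 ≤ γ k) (hη : ∀ k, |η k| ≤ ηbar) (hηbar : ηbar ≤ 1 / 2) (ht : 0 < t) (ht4 : t ≤ 1 / 4)
    {G F : Finset ℕ} (hG : ∀ k ∈ G, rem k = true) (hGF : G ⊆ F) :
    ∑ k ∈ F, theftTerm γ η rem t k
      ≤ 601 * A * ηbar * t ^ 2 * Real.log (1 / t) - ∑ k ∈ G, pairTrace (γ k) t := by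
  classical
  rw [← Finset.sum_filter_add_sum_filter_not F (fun k ↦ rem k = true)]
  have h1 : ∑ k ∈ F with rem k = true, theftTerm γ η rem t k
      = -∑ k ∈ F with rem k = true, pairTrace (γ k) t := by
    rw [← Finset.sum_neg_distrib]
    exact Finset.sum_congr rfl fun k hk ↦ by simp [theftTerm, (Finset.mem_filter.mp hk).2]
  have h2 : ∑ k ∈ F with ¬ rem k = true, theftTerm γ η rem t k
      = ∑ k ∈ F with ¬ rem k = true, (pairTrace (γ k + η k) t - pairTrace (γ k) t) :=
    Finset.sum_congr rfl fun k hk ↦ by simp [theftTerm, (Finset.mem_filter.mp hk).2]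
  rw [h1, h2]
  have hsub : G ⊆ F.filter fun k ↦ rem k = true := fun k hk ↦
    Finset.mem_filter.mpr ⟨hGF hk, hG k hk⟩
  have hmono : ∑ k ∈ G, pairTrace (γ k) t ≤ ∑ k ∈ F with rem k = true, pairTrace (γ k) t :=
    Finset.sum_le_sum_of_subset_of_nonneg hsub fun k _ _ ↦ pairTrace_nonneg _ _
  have hslide := abs_sum_slide_le_of_countHyp hA hγ hη hηbar ht ht4 (F.filter fun k ↦ ¬ rem k = true)
  have hs := le_abs_self (∑ k ∈ F with ¬ rem k = true, (pairTrace (γ k + η k) t - pairTrace (γ k) t))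
  linarith

/-- Limit form: if the partial sums over all `F ⊇ G` are `≤ c`, so is the sum. -/
theorem le_of_hasSum_of_sum_le {f : ℕ → ℝ} {s c : ℝ} (hs : HasSum f s) (G : Finset ℕ)
    (hc : ∀ F : Finset ℕ, G ⊆ F → ∑ k ∈ F, f k ≤ c) : s ≤ c :=
  le_of_tendsto hs (Filter.eventually_atTop.2 ⟨G, fun F hF ↦ hc F hF⟩)

/-- **K7′ NECESSARY CONDITION, SECOND SIDE — THE UPPER COUNT LAW («over-removal is impossible»).**  Under
`GermHyp σ* Z`, a removal + sliding theft on `|t| ≤ U` with slides `≤ η̄ ≤ 1/2` satisfies, at every height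
`Y ≥ max(4, 1/U)` and for every finite set `G` of REMOVED indices:
`(11/12)·#{k ∈ G : γ_k ≤ Y} ≤ towerSmooth_Z(Y) + 601·A·η̄·log Y`.
In words: below each height one cannot remove more zeros than a smoothed weight of the tower at that height,
up to the sliding slack `O(η̄ log Y)`; with §14, the removed count is tied to the tower's weight from both sides
within constant factors.  The exact two-sided exchange (factor `2`) is theory-1's paper form; and, as in §14,
this does NOT decide B33 Q_C clause 3 / K7′ (existence of such thefts is the open construction question). -/
theorem removedNear_le_of_removalSlidingTheft {σs U ηbar A : ℝ} {Z : Config} (hZ : GermHyp σs Z)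
    (hU : 0 < U) (hηbar : ηbar ≤ 1 / 2) {γ η : ℕ → ℝ} {rem : ℕ → Bool}
    (hT : RemovalSlidingTheft U ηbar A Z γ η rem) {Y : ℝ} (hY4 : 4 ≤ Y) (hYU : 1 / U ≤ Y)
    (G : Finset ℕ) (hG : ∀ k ∈ G, rem k = true) :
    11 / 12 * ((G.filter fun k ↦ γ k ≤ Y).card : ℝ) ≤ towerSmooth Z Y + 601 * A * ηbar * Real.log Y := by
  classical
  obtain ⟨hA, hγ, hη, hid⟩ := hT
  have hYpos : 0 < Y := by linarith
  set t := 1 / Y with ht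
  have htpos : 0 < t := by positivity
  have ht4 : t ≤ 1 / 4 := one_div_le_one_div_of_le (by norm_num) hY4
  have htU : |t| ≤ U := by rw [abs_of_pos htpos]; exact (one_div_le hYpos hU).mpr hYU
  have hYt : 1 / t = Y := one_div_one_div Y
  -- the sum `−Ψ_Z(t)` is `≤ 601 A η̄ t² log Y − Σ_G g`
  have hup := le_of_hasSum_of_sum_le (hid t htU) G
    fun F hF ↦ sum_theftTerm_le hA hγ hη hηbar htpos ht4 hG hF
  rw [hYt] at hup
  -- near removed pairs supply `≥ (11/12) t²` each
  have hnear : 11 / 12 * t ^ 2 * ((G.filter fun k ↦ γ k ≤ Y).card : ℝ)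
      ≤ ∑ k ∈ G, pairTrace (γ k) t := by
    have hsub : (G.filter fun k ↦ γ k ≤ Y) ⊆ G := Finset.filter_subset _ _
    refine le_trans ?_ (Finset.sum_le_sum_of_subset_of_nonneg hsub fun k _ _ ↦ pairTrace_nonneg _ _)
    have hterm : ∀ k ∈ G.filter (fun k ↦ γ k ≤ Y), 11 / 12 * t ^ 2 ≤ pairTrace (γ k) t := by
      intro k hk
      have hkY : γ k ≤ Y := (Finset.mem_filter.mp hk).2
      have hγk : 0 < γ k := by linarith [hγ k]
      have hγt : γ k * t ≤ 1 := by
        rw [ht, mul_one_div, div_le_one hYpos]; exact hkY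
      have hγt0 : 0 ≤ γ k * t := by positivity
      have hp : (γ k * t) ^ 2 ≤ 1 := pow_le_one₀ hγt0 hγt
      have hg := sq_sub_le_pairTrace hγk.ne' t
      have e : γ k ^ 2 * t ^ 4 / 12 = (γ k * t) ^ 2 * t ^ 2 / 12 := by ring
      nlinarith [mul_le_mul_of_nonneg_right hp (sq_nonneg t)]
    calc 11 / 12 * t ^ 2 * ((G.filter fun k ↦ γ k ≤ Y).card : ℝ)
        = ∑ k ∈ G.filter (fun k ↦ γ k ≤ Y), 11 / 12 * t ^ 2 := by
          rw [Finset.sum_const, nsmul_eq_mul]; ring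
      _ ≤ ∑ k ∈ G.filter (fun k ↦ γ k ≤ Y), pairTrace (γ k) t := Finset.sum_le_sum hterm
  -- tower side
  have hψ : Z.psi t ≤ t ^ 2 * towerSmooth Z Y := Config.psi_le_towerSmooth hZ (by linarith)
  have ht2 : 0 < t ^ 2 := by positivity
  have key : t ^ 2 * (11 / 12 * ((G.filter fun k ↦ γ k ≤ Y).card : ℝ))
      ≤ t ^ 2 * (towerSmooth Z Y + 601 * A * ηbar * Real.log Y) := by nlinarith
  exact le_of_mul_le_mul_left key ht2

/-- Sanity instance: for the pure sliding theft (`rem ≡ false`) the only admissible `G` is `∅` and the upper law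
reads `0 ≤ towerSmooth_Z(Y) + 601·A·η̄·log Y` — no hidden content on that side. -/
theorem removedNear_le_trivial {σs A ηbar Y : ℝ} {Z : Config} (hZ : GermHyp σs Z) (hA : 0 ≤ A) (hη : 0 ≤ ηbar)
    (hY : 1 ≤ Y) : (0 : ℝ) ≤ towerSmooth Z Y + 601 * A * ηbar * Real.log Y := by
  have := towerSmooth_nonneg hZ Y
  have hl : 0 ≤ Real.log Y := Real.log_nonneg hY
  positivity

end Summit.RiemannHypothesis.RiemannHypothesis.Theorems.Splittings.SlidingGerm
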